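import Mathlib.FieldTheory.RatFunc.AsPolynomial
import Mathlib.FieldTheory.IsAlgClosed.Basic
import Mathlib.RingTheory.Algebraic.Basic
import Mathlib.Algebra.CharZero.Infinite
import HarnessLib

/-!
# [IUTchI] Remark 3.1.7 (i), (ii), (iii): `κ`-coric rational functions

S. Mochizuki, *Inter-universal Teichmüller theory I*, §3, Remark 3.1.7 (kurims final manuscript
May 2020, pp. 66–68) [claim: Mochizuki2012, status: disputed]. Typed as DEFINITIONS plus the
elementary claims printed there; nothing of the series' disputed content is involved, but the
bibliographic key carries the D-0012 status, hence the tag form.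

**Setting (Rmk 3.1.7 (i)).** `L` is `F_mod` or a completion `(F_mod)_v`; `C_L` is the model of
`C_F` over `L`; its coarse space `|C_L|` "is isomorphic to the affine line over `L`", and the
compactification `|C_L|^cpt ≅ ℙ¹_L` has `4` *critical points*: the images of the `2`-torsion points
of `E_F`, namely the unique cusp of `C_L` (image of the origin) and the `3` *strictly critical*
points. A rational function `f ∈ L_C` (the function field of `C_L`) is **`κ`-coric** if
* whenever `f ∉ L`, `f` has, over `L̄`, precisely one pole (of unrestricted order) but at least two
  distinct zeroes;
* the divisor of zeroes and poles of `f` is defined over a number field and avoids the critical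
  points;
* `f` restricts to a root of unity at every strictly critical point of `|C_L|^cpt`.

**Typing.** We work geometrically, over a field `Ω` (to be thought of as `L̄`, or any field over
which the divisor of `f` splits), with the affine coordinate `t` on `|C_L| ≅ 𝔸¹` chosen so that the
cusp is the point at infinity; the strictly critical points are a `3`-element `Finset Ω`
(`CriticalLocus`); `f` is a Mathlib `RatFunc Ω` with normalised numerator/denominator
`f.num / f.denom`. "Avoids the cusp" becomes `deg num = deg denom` (no zero or pole at `∞`);
"defined over a number field" becomes "all zeroes and poles are algebraic over `ℚ`".
Then (ii): `∞κ`-coric (`fⁿ` is `κ`-coric for some `n ≥ 1`), `∞κ×`-coric (`c·f` is `∞κ`-coric for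
some `c ∈ U_L`, with `U_L` a parameter: `L^×` for `L = F_mod`, the units `𝒪^×` for `L = (F_mod)_v`),
and (iii): `κ`-solvable (an `F_sol^×`-multiple of an `∞κ`-coric element; `F_sol^×` a parameter).

Proved here (printed as "it follows that"): if `f` and `c·f` are both `κ`-coric then `c` is a
root of unity (p. 67). Typed as `Prop`s, NOT proved here: "never both `f` and `f⁻¹` are `κ`-coric"
(p. 67); "`κ`-coric iff `∞κ`-coric"; the `∞κ×`/`∞κ` criterion (p. 67); existence of a `κ`-coric
`f_sol` of degree `4` and the value-surjectivity statements of (ii); the pseudo-monoid structures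
(p. 68, [IUTchI] §0); all of (iii) beyond the definition of `κ`-solvable and all of (iv)
(`Aut_{κ-sol}`, center-freeness via [NodNon] Thm C) — these need the function-field Galois theory
of `C_K` and are left to a later file. TODO-merge: abc-iut-L5-t1 (§0 pseudo-monoids).
-/

namespace Literature.IUT.HodgeTheaters

open Polynomial
open scoped RatFunc Classical

universe u

variable {Ω : Type u} [Field Ω]

/-- The *strictly critical* locus of `|C_L|^cpt ≅ ℙ¹` in the affine coordinate for which the cusp
is `∞`: the `3` points arising from the nonzero `2`-torsion points of `E_F` (Rmk 3.1.7 (i): "precisely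
`4` critical points", the fourth being the cusp). [claim: Mochizuki2012, status: disputed] -/
structure CriticalLocus (Ω : Type u) [Field Ω] where
  /-- the three strictly critical points -/
  pts : Finset Ω
  /-- there are exactly three of them -/
  card_eq : pts.card = 3

namespace CriticalLocus

variable (S : CriticalLocus Ω)

/-- The zeroes (in `Ω`) of a rational function `f`: roots of its normalised numerator.
[claim: Mochizuki2012, status: disputed] -/
noncomputable def zeroes (f : RatFunc Ω) : Finset Ω := f.num.roots.toFinset

/-- The poles (in `Ω`) of a rational function `f`: roots of its normalised denominator.
[claim: Mochizuki2012, status: disputed] -/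
noncomputable def poles (f : RatFunc Ω) : Finset Ω := f.denom.roots.toFinset

/-- Rmk 3.1.7 (i), second condition, geometric half: "the divisor of zeroes and poles of `f` …
avoids the critical points" — no strictly critical point is a zero or a pole, and the cusp `∞` is
neither (equal degrees of numerator and denominator). [claim: Mochizuki2012, status: disputed] -/
structure AvoidsCritical (f : RatFunc Ω) : Prop where
  /-- no zero at a strictly critical point -/
  num_eval_ne : ∀ e ∈ S.pts, f.num.eval e ≠ 0
  /-- no pole at a strictly critical point -/
  denom_eval_ne : ∀ e ∈ S.pts, f.denom.eval e ≠ 0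
  /-- no zero or pole at the cusp `∞` -/
  natDegree_eq : f.num.natDegree = f.denom.natDegree

/-- Rmk 3.1.7 (i): `f` is **`κ`-coric** ("`κ` as standing for 'Kummer'"). The three printed
conditions, read over `Ω ⊇ L` with the cusp at `∞`; `[CharZero Ω]` supplies the `ℚ`-algebra
structure used to say "defined over a number field". [claim: Mochizuki2012, status: disputed] -/
structure IsKappaCoric [CharZero Ω] (f : RatFunc Ω) : Prop where
  /-- "whenever `f ∉ L`, … `f` has precisely one pole [of unrestricted order], but at least two
  distinct zeroes" (for `f` avoiding `∞`, `f ∉ L` iff `f` is not a constant `RatFunc.C c`) -/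
  one_pole_two_zeroes : (∀ c : Ω, f ≠ RatFunc.C c) → (poles f).card = 1 ∧ 2 ≤ (zeroes f).card
  /-- "the divisor of zeroes and poles of `f` is defined over a number field …" -/
  divisor_algebraic : ∀ z ∈ zeroes f ∪ poles f, IsAlgebraic ℚ z
  /-- "… and avoids the critical points" -/
  avoids : S.AvoidsCritical f
  /-- "`f` restricts to a root of unity at every strictly critical point of `|C_L|^cpt`" -/
  rootOfUnity_at_critical : ∀ e ∈ S.pts, ∃ n : ℕ, 0 < n ∧ (f.eval (RingHom.id Ω) e) ^ n = 1

/-- Rmk 3.1.7 (ii): `f` is **`∞κ`-coric** if "there exists a positive integer `n` such that `fⁿ`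
is a `κ`-coric element". [claim: Mochizuki2012, status: disputed] -/
def IsInftyKappaCoric [CharZero Ω] (f : RatFunc Ω) : Prop :=
  ∃ n : ℕ, 0 < n ∧ S.IsKappaCoric (f ^ n)

/-- Rmk 3.1.7 (ii): `f` is **`∞κ×`-coric** if "there exists an element `c ∈ U_L` such that `c·f`
is `∞κ`-coric", where `U_L = L^×` if `L = F_mod` and `U_L =` the units of `L` if
`L = (F_mod)_v`; `U_L` is the parameter `U` (a subset of `Ω`). [claim: Mochizuki2012, status: disputed] -/
def IsInftyKappaUnitCoric [CharZero Ω] (U : Set Ω) (f : RatFunc Ω) : Prop :=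
  ∃ c ∈ U, S.IsInftyKappaCoric (RatFunc.C c * f)

/-- Rmk 3.1.7 (iii) (with `L = F_mod`, `L̄ = F̄`): `f` is **`κ`-solvable** if "it is an
`F_sol^×`-multiple of an `∞κ`-coric element", `F_sol` the maximal solvable extension of `F_mod`
(Def. 3.1 (b)); `F_sol^×` is the parameter `Fsol`. [claim: Mochizuki2012, status: disputed] -/
def IsKappaSolvable [CharZero Ω] (Fsol : Set Ω) (f : RatFunc Ω) : Prop :=
  ∃ c ∈ Fsol, c ≠ 0 ∧ ∃ g : RatFunc Ω, S.IsInftyKappaCoric g ∧ f = RatFunc.C c * g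

/-! ### The printed elementary consequences -/

section Claims

variable [CharZero Ω]

/-- Rmk 3.1.7 (i), p. 67: "it follows from the third displayed condition that if `c ∈ L̄` and
`f ∈ L_C` are such that both `f` and `c·f` are `κ`-coric, then `c` is a root of unity" — PROVED
(evaluate at a strictly critical point). [claim: Mochizuki2012, status: disputed] -/
theorem IsKappaCoric.isRootOfUnity_of_smul {f : RatFunc Ω} {c : Ω} (hf : S.IsKappaCoric f)
    (hcf : S.IsKappaCoric (RatFunc.C c * f)) : ∃ n : ℕ, 0 < n ∧ c ^ n = 1 := by
  -- a strictly critical point exists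
  obtain ⟨e, he⟩ : S.pts.Nonempty := by
    rw [← Finset.card_pos, S.card_eq]; norm_num
  obtain ⟨n, hn, hfe⟩ := hf.rootOfUnity_at_critical e he
  obtain ⟨m, hm, hcfe⟩ := hcf.rootOfUnity_at_critical e he
  have hden : Polynomial.eval₂ (RingHom.id Ω) e f.denom ≠ 0 := by
    rw [Polynomial.eval₂_id]; exact hf.avoids.denom_eval_ne e he
  have hC : Polynomial.eval₂ (RingHom.id Ω) e (RatFunc.C c).denom ≠ 0 := by
    rw [RatFunc.denom_C]; simp
  rw [RatFunc.eval_mul (f := RingHom.id Ω) (a := e) hC hden, RatFunc.eval_C, RingHom.id_apply] at hcfe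
  -- `f(e)` is a unit: `f(e)ⁿ = 1`
  have hfe_ne : RatFunc.eval (RingHom.id Ω) e f ≠ 0 := by
    intro h; rw [h, zero_pow hn.ne'] at hfe; exact zero_ne_one hfe
  refine ⟨m * n, Nat.mul_pos hm hn, ?_⟩
  have h1 : (c * RatFunc.eval (RingHom.id Ω) e f) ^ (m * n) = 1 := by
    rw [pow_mul, hcfe, one_pow]
  have h2 : (RatFunc.eval (RingHom.id Ω) e f) ^ (m * n) = 1 := by
    rw [mul_comm m n, pow_mul, hfe, one_pow]
  rw [mul_pow, h2, mul_one] at h1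
  exact h1

/-- Rmk 3.1.7 (i), p. 67: "it follows from the first displayed condition that, whenever `f ∉ L`,
it is never the case that both `f` and `f⁻¹` are `κ`-coric" (the inverse has at least two distinct
poles) — typed as a statement. [claim: Mochizuki2012, status: disputed] -/
def NotBothKappaCoric (f : RatFunc Ω) : Prop :=
  (∀ c : Ω, f ≠ RatFunc.C c) → ¬ (S.IsKappaCoric f ∧ S.IsKappaCoric f⁻¹)

/-- Rmk 3.1.7 (ii), p. 67: "an element `f ∈ L_C` is `κ`-coric if and only if it is `∞κ`-coric" —
typed as a statement. [claim: Mochizuki2012, status: disputed] -/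
def KappaCoricIffInfty (f : RatFunc Ω) : Prop :=
  S.IsKappaCoric f ↔ S.IsInftyKappaCoric f

/-- Rmk 3.1.7 (ii), p. 67: "an `∞κ×`-coric element `f` is `∞κ`-coric if and only if it restricts to
a root of unity at some [or, equivalently, every] strictly critical point" — typed as a statement
(both readings). [claim: Mochizuki2012, status: disputed] -/
def InftyKappaUnitCoricCriterion (U : Set Ω) (f : RatFunc Ω) : Prop :=
  S.IsInftyKappaUnitCoric U f →
    ((S.IsInftyKappaCoric f ↔ ∃ e ∈ S.pts, ∃ n : ℕ, 0 < n ∧ (f.eval (RingHom.id Ω) e) ^ n = 1) ∧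
     (S.IsInftyKappaCoric f ↔ ∀ e ∈ S.pts, ∃ n : ℕ, 0 < n ∧ (f.eval (RingHom.id Ω) e) ^ n = 1))

/-- Rmk 3.1.7 (ii), p. 67: "since `|C_L|^cpt` has precisely `4` critical points, it follows
immediately from the elementary theory of polynomial functions on the affine line … that there
exists a `κ`-coric `f_sol ∈ L_C` of degree `4`" — typed as a statement over `Ω` (degree = degree of
the numerator = of the denominator). [claim: Mochizuki2012, status: disputed] -/
def ExistsKappaCoricDegreeFour : Prop :=
  ∃ f : RatFunc Ω, S.IsKappaCoric f ∧ f.num.natDegree = 4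

/-- Rmk 3.1.7 (ii), p. 67, displayed statement: "every element of `L̄` (respectively, `L^⊡`)
appears as a value of some `κ`-coric rational function on `C_L` at some `L̄`- (respectively, `L^⊡`-)
valued point of `C_L` that is not critical" — typed for a subfield-like subset `M ⊆ Ω` (take
`M = Ω = L̄`, or `M =` a solvably closed `L^⊡`). [claim: Mochizuki2012, status: disputed] -/
def EveryValueAttained (M : Set Ω) : Prop :=
  ∀ a ∈ M, ∃ f : RatFunc Ω, S.IsKappaCoric f ∧ ∃ t ∈ M, t ∉ S.pts ∧ f.denom.eval t ≠ 0 ∧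
    f.eval (RingHom.id Ω) t = a

end Claims

end CriticalLocus

end Literature.IUT.HodgeTheaters
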